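import Mathlib
import HarnessLib
import Summits.HubbardSuperconductivity.HubbardSuperconductivity.Theorems.KLProgrammeC4aPPKernelFirstOrderRows

/-!
# Route `KLProgramme` — crux C4a, S3 brick (B4) «(U1)-HYBRID» kernel side: THE SWAP PIECE `swap A_s (e,u) = A_s(u,e) = P(e,u)·κ(1 − r̃(e,u))` OF THE SMOOTH PARTITION
# `P = A_s + swap A_s + M_s` — its partner-level derivative, value / derivative / strip envelopes WITHOUT any support or shell-structure hypothesis, joint continuity,
# and the six kernel rows of B-1 (vi) `firstOrderLayer_abs_le` for `Kr := swap A_s/C` (+ the concrete-profile twin)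

Cell `gate-hubbard-kl`, seat hubbard-kl-k3c3-p1 (g19; row «δμ-flow with klAngularMean constant piece»).  Located question «SWAP-PIECE-UMK» (this seat, KL STATUS
2026-08-29 ≈18:1xZ; located-candidate #12 of pen g28): the umklapp number `U` of record is built from the far and comparable pieces only; the swap piece lives where the
PARTNER scale is small against the loop level (`(1−t₁)·m̃ᵤ < t₁·m̃ₑ`, so `|u| < (2/3)|e|` for `t₁ ≤ 2/5`) — U7 cannot read it (its support row `|u| ≤ q_s·e ⇒ (Kr e)′ u = 0`
fails), but its analysis is ELEMENTARY: the loop level is far from the Fermi surface relative to the partner, `e + u ≠ 0` on the support, no caustic / flatness structure.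
* `hasDerivAt_ppFarKernelS_swap_u` — `∂ᵤ[swap A_s](e,u) = ∂ᵤP·κ(1−r̃) − P·κ′(1−r̃)·r̃′`; `contDiff_two_ppFarKernelS_swap_u`; `continuous_deriv_ppFarKernelS_swap₂`;
* `abs_ppFarKernelS_swap_le_inv_max` (`e ≠ 0`: `≤ κ₀(12B₁+9)·(max |e| |u|)⁻¹`), **`abs_deriv_ppFarKernelS_swap_le`** (`0 < |e| ≤ K·Λ`:
  `≤ (κ₀(64B₂+120B₁+158+(12B₁+5)K) + κ₁(12B₁+9))·(max |e| |u|)⁻¹²` — the ALL-`u` envelope of `∂ᵤP` at near-shell loop levels + `|r̃′| ≤ 1/(m̃ₑ+m̃ᵤ)`),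
  `abs_ppFarKernelS_swap_strip_le` / `abs_deriv_ppFarKernelS_swap_strip_le` (`|e| ≤ lo ≤ Λ`: `8κ₀·(max lo |u|)⁻¹`, `(κ₀(128B₁+72)+8κ₁)·(max lo |u|)⁻¹²`);
* **`ppFarKernelSSwap_firstOrderRows`** — the six rows `hKd hKc hK0 hK0s hK1 hKs1` of B-1 (vi) for `Kr := fun e u => ppFarKernelS β Λ κ lo u e / C`, normalisation
  `κ₀(12B₁+9) ≤ C`, `κ₀(64B₂+120B₁+158+(12B₁+5)K) + κ₁(12B₁+9) ≤ C`, `κ₀(128B₁+72)+8κ₁ ≤ C`, level box `hi ≤ K·Λ` (`1 ≤ K`); NO hypothesis on the profile's death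
  (only `κ ∈ C²`, `|κ|, |κ′|` bounded on `[0,1]`); **`ppFarKernelSSwapSplit_firstOrderRows`** — at `sκ := ppSplitProfile t₁`, `C := Cˢʷ(B₁,B₂,K,t₁) :=
  (12B₁+9) + (64B₂+120B₁+158+(12B₁+5)K + (6/t₁)(12B₁+9)) + (128B₁+72 + 48/t₁)`.
Support (for the record, already landed): `ppFarKernelS_eq_zero_of_abs_le` with the arguments swapped kills the swap piece wherever `|e| ≤ q_s·|u|`.
Pure real analysis on Literature objects; nothing asserts (C), K3, the window or superconductivity.
References: BGM 2006 §2.4 (2.36) [cite: BenfattoGiulianiMastropietro2006]; FST II CPAM 51 (1998) §3 [cite: FeldmanSalmhoferTrubowitz1998].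
-/

noncomputable section

namespace Summit.HubbardSuperconductivity.HubbardSuperconductivity.Theorems.C4a

set_option linter.dupNamespace false -- summit = problem name (single-conjunct summit), D-0017

open Real Set MeasureTheory
open Literature.MathematicalPhysics.QuantumLattice Literature.Analysis.SpecialFunctions

section Swap

variable {β Λ : ℝ} (hβ : 0 < β) (hΛ : 0 < Λ) {B₁ B₂ : ℝ} (hB₁ : ∀ x, |deriv salmhoferCutoff x| ≤ B₁) (hB₂ : ∀ x, |deriv (deriv salmhoferCutoff) x| ≤ B₂)
  {κ κ' κ'' : ℝ → ℝ} (hκ : ∀ t, HasDerivAt κ (κ' t) t) (hκ' : ∀ t, HasDerivAt κ' (κ'' t) t) (hκ''c : Continuous κ'')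
  {κ₀ κ₁ : ℝ} (hκb : ∀ t ∈ Icc 0 1, |κ t| ≤ κ₀) (hκ'b : ∀ t ∈ Icc 0 1, |κ' t| ≤ κ₁)
  {lo : ℝ} (hlo : 0 < lo) (hloΛ : lo ≤ Λ)

include hlo in
/-- The swap piece as a function of the partner level: `v ↦ A_s(v,e) = P(e,v)·κ(1 − r̃(e,v))`. [folklore] -/
theorem ppFarKernelS_swap_fun (e : ℝ) :
    (fun v : ℝ => ppFarKernelS β Λ κ lo v e) = fun v => ppTrueKernel β Λ e v * κ (1 - ppSmoothRatio lo e v) :=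
  funext fun v => ppFarKernelS_swap κ hlo e v

include hβ hΛ hB₁ hκ hlo in
/-- **`∂ᵤ[swap A_s](e,u) = ∂ᵤP·κ(1−r̃) + P·κ′(1−r̃)·(−r̃′)`**, `r̃′ = −m̃ₑ(u/m̃ᵤ)/(m̃ₑ+m̃ᵤ)²`. [cite: BenfattoGiulianiMastropietro2006, §2.4 (2.36)] -/
theorem hasDerivAt_ppFarKernelS_swap_u (e u : ℝ) :
    HasDerivAt (fun v : ℝ => ppFarKernelS β Λ κ lo v e)
      (ppTrueKernelDu β Λ e u * κ (1 - ppSmoothRatio lo e u) +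
        ppTrueKernel β Λ e u * (κ' (1 - ppSmoothRatio lo e u) * (-(-(ppSmoothScale lo e * (u / ppSmoothScale lo u)) / (ppSmoothScale lo e + ppSmoothScale lo u) ^ 2)))) u := by
  rw [ppFarKernelS_swap_fun hlo e]
  have hr : HasDerivAt (fun v : ℝ => 1 - ppSmoothRatio lo e v) (-(-(ppSmoothScale lo e * (u / ppSmoothScale lo u)) / (ppSmoothScale lo e + ppSmoothScale lo u) ^ 2)) u := (hasDerivAt_ppSmoothRatio_u hlo e u).const_sub 1
  exact (hasDerivAt_ppTrueKernel_u hβ hΛ hB₁ e u).fun_mul ((hκ _).comp u hr)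

include hβ hΛ hB₁ hB₂ hκ hκ' hκ''c hlo in
/-- **`u ↦ swap A_s(e,u)` is `C²`** at every loop level. [cite: BenfattoGiulianiMastropietro2006, §2.4 (2.36)] -/
theorem contDiff_two_ppFarKernelS_swap_u (e : ℝ) : ContDiff ℝ 2 (fun v : ℝ => ppFarKernelS β Λ κ lo v e) := by
  rw [ppFarKernelS_swap_fun hlo e]
  exact (contDiff_two_ppTrueKernel_u hβ hΛ hB₁ hB₂ e).mul
    ((contDiff_two_of_hasDerivAt₂ hκ hκ' hκ''c).comp (contDiff_const.sub (contDiff_ppSmoothRatio hlo e)))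

include hβ hΛ hB₁ hκ hlo in
/-- **Joint continuity of `∂ᵤ[swap A_s]` on ℝ²** (row `hKc`). [cite: BenfattoGiulianiMastropietro2006, §2.4 (2.36)] -/
theorem continuous_deriv_ppFarKernelS_swap₂ (hκ'c : Continuous κ') :
    Continuous fun p : ℝ × ℝ => deriv (fun v : ℝ => ppFarKernelS β Λ κ lo v p.1) p.2 := by
  have hd : ∀ p : ℝ × ℝ, deriv (fun v : ℝ => ppFarKernelS β Λ κ lo v p.1) p.2 =
      ppTrueKernelDu β Λ p.1 p.2 * κ (1 - ppSmoothRatio lo p.1 p.2) +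
        ppTrueKernel β Λ p.1 p.2 * (κ' (1 - ppSmoothRatio lo p.1 p.2) *
          (-(-(ppSmoothScale lo p.1 * (p.2 / ppSmoothScale lo p.2)) / (ppSmoothScale lo p.1 + ppSmoothScale lo p.2) ^ 2))) :=
    fun p => (hasDerivAt_ppFarKernelS_swap_u hβ hΛ hB₁ hκ hlo p.1 p.2).deriv
  simp_rw [hd]
  have hκc : Continuous κ := continuous_iff_continuousAt.2 fun t => (hκ t).continuousAt
  have hr : Continuous fun p : ℝ × ℝ => ppSmoothRatio lo p.1 p.2 := continuous_ppSmoothRatio₂ hlo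
  have hr1 : Continuous fun p : ℝ × ℝ => 1 - ppSmoothRatio lo p.1 p.2 := continuous_const.sub hr
  have hP : Continuous fun p : ℝ × ℝ => ppTrueKernel β Λ p.1 p.2 := continuous_ppTrueKernel_comp hβ Λ continuous_fst continuous_snd
  have hP' : Continuous fun p : ℝ × ℝ => ppTrueKernelDu β Λ p.1 p.2 := continuous_ppTrueKernelDu_comp hβ hΛ hB₁ continuous_fst continuous_snd
  have hSe : Continuous fun p : ℝ × ℝ => ppSmoothScale lo p.1 := (contDiff_ppSmoothScale hlo (n := 0)).continuous.comp continuous_fst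
  have hSu : Continuous fun p : ℝ × ℝ => ppSmoothScale lo p.2 := (contDiff_ppSmoothScale hlo (n := 0)).continuous.comp continuous_snd
  have hr0 : Continuous fun p : ℝ × ℝ => -(ppSmoothScale lo p.1 * (p.2 / ppSmoothScale lo p.2)) / (ppSmoothScale lo p.1 + ppSmoothScale lo p.2) ^ 2 := by
    refine Continuous.div ((hSe.mul (continuous_snd.div hSu fun p => (ppSmoothScale_pos hlo _).ne')).neg) ((hSe.add hSu).pow 2) fun p => ?_
    have := ppSmoothScale_pos hlo p.1; have := ppSmoothScale_pos hlo p.2; positivity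
  have hr' : Continuous fun p : ℝ × ℝ => -(-(ppSmoothScale lo p.1 * (p.2 / ppSmoothScale lo p.2)) / (ppSmoothScale lo p.1 + ppSmoothScale lo p.2) ^ 2) :=
    hr0.neg
  exact (hP'.mul (hκc.comp hr1)).add (hP.mul ((hκ'c.comp hr1).mul hr'))

include hlo in
/-- `1 − r̃(e,u) ∈ (0,1)`. [folklore] -/
theorem one_sub_ppSmoothRatio_mem_Icc (e u : ℝ) : 1 - ppSmoothRatio lo e u ∈ Icc (0 : ℝ) 1 := by
  have h := ppSmoothRatio_mem_Ioo hlo e u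
  exact ⟨by linarith [h.2], by linarith [h.1]⟩

include hβ hΛ hB₁ hκb hlo in
/-- **Value envelope (row `hK0`)**: `e ≠ 0 ⟹ |swap A_s(e,u)| ≤ κ₀(12B₁+9)·(max |e| |u|)⁻¹`. [cite: BenfattoGiulianiMastropietro2006, §2.4 (2.36)] -/
theorem abs_ppFarKernelS_swap_le_inv_max {e : ℝ} (he : e ≠ 0) (u : ℝ) :
    |ppFarKernelS β Λ κ lo u e| ≤ κ₀ * (12 * B₁ + 9) * (max |e| |u|)⁻¹ := by
  have hκ₀ : 0 ≤ κ₀ := (abs_nonneg _).trans (hκb 0 (left_mem_Icc.2 zero_le_one))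
  rw [ppFarKernelS_swap κ hlo e u, abs_mul]
  have hP := abs_ppTrueKernel_le_inv_max_abs hβ hΛ hB₁ he u
  have hk := hκb _ (one_sub_ppSmoothRatio_mem_Icc hlo e u)
  calc |ppTrueKernel β Λ e u| * |κ (1 - ppSmoothRatio lo e u)| ≤ (12 * B₁ + 9) * (max |e| |u|)⁻¹ * κ₀ :=
        mul_le_mul hP hk (abs_nonneg _) (by have := salmhoferB₁_nonneg hB₁; positivity)
    _ = κ₀ * (12 * B₁ + 9) * (max |e| |u|)⁻¹ := by ring

include hβ hΛ hκb hlo hloΛ in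
/-- **Strip value envelope (row `hK0s`)**: `|e| ≤ lo ≤ Λ ⟹ |swap A_s(e,u)| ≤ 8κ₀·(max lo |u|)⁻¹`. [cite: BenfattoGiulianiMastropietro2006, §2.4 (2.36)] -/
theorem abs_ppFarKernelS_swap_strip_le {e : ℝ} (he : |e| ≤ lo) (u : ℝ) :
    |ppFarKernelS β Λ κ lo u e| ≤ 8 * κ₀ * (max lo |u|)⁻¹ := by
  have hκ₀ : 0 ≤ κ₀ := (abs_nonneg _).trans (hκb 0 (left_mem_Icc.2 zero_le_one))
  have heΛ : |e| ≤ Λ := he.trans hloΛ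
  have hm0 : 0 < max lo |u| := lt_max_of_lt_left hlo
  have hmm : (max Λ |u|)⁻¹ ≤ (max lo |u|)⁻¹ := by
    rw [inv_le_inv₀ (lt_max_of_lt_left hΛ) hm0]; exact max_le_max hloΛ le_rfl
  rw [ppFarKernelS_swap κ hlo e u, abs_mul]
  have hP := (abs_ppTrueKernel_strip_le_inv_max hβ hΛ heΛ u).trans (mul_le_mul_of_nonneg_left hmm (by norm_num))
  have hk := hκb _ (one_sub_ppSmoothRatio_mem_Icc hlo e u)
  calc |ppTrueKernel β Λ e u| * |κ (1 - ppSmoothRatio lo e u)| ≤ 8 * (max lo |u|)⁻¹ * κ₀ := mul_le_mul hP hk (abs_nonneg _) (by positivity)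
    _ = 8 * κ₀ * (max lo |u|)⁻¹ := by ring

set_option maxHeartbeats 400000 in
include hβ hΛ hB₁ hB₂ hκ hκb hκ'b hlo in
/-- **Derivative envelope (row `hK1`) at near-shell loop levels, ALL partner levels**: `e ≠ 0`, `|e| ≤ K·Λ`, `1 ≤ K` ⟹
`|∂ᵤ[swap A_s](e,u)| ≤ (κ₀(64B₂+120B₁+158+(12B₁+5)K) + κ₁(12B₁+9))·(max |e| |u|)⁻¹²` (no support condition: the all-`u` envelope of `∂ᵤP` + `|r̃′| ≤ (max |e| |u|)⁻¹`).
[cite: BenfattoGiulianiMastropietro2006, §2.4 (2.36)] -/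
theorem abs_deriv_ppFarKernelS_swap_le {K e : ℝ} (hK : 1 ≤ K) (he : e ≠ 0) (heK : |e| ≤ K * Λ) (u : ℝ) :
    |deriv (fun v : ℝ => ppFarKernelS β Λ κ lo v e) u| ≤
      (κ₀ * (64 * B₂ + 120 * B₁ + 158 + (12 * B₁ + 5) * K) + κ₁ * (12 * B₁ + 9)) * (max |e| |u|)⁻¹ ^ 2 := by
  have hB0 := salmhoferB₁_nonneg hB₁
  have hB20 : 0 ≤ B₂ := (abs_nonneg _).trans (hB₂ 0)
  have hκ₀ : 0 ≤ κ₀ := (abs_nonneg _).trans (hκb 0 (left_mem_Icc.2 zero_le_one))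
  have hκ₁ : 0 ≤ κ₁ := (abs_nonneg _).trans (hκ'b 0 (left_mem_Icc.2 zero_le_one))
  have hK0 : 0 ≤ K := zero_le_one.trans hK
  set M : ℝ := max |e| |u| with hM
  have hM0 : 0 < M := lt_max_of_lt_left (abs_pos.2 he)
  rw [(hasDerivAt_ppFarKernelS_swap_u hβ hΛ hB₁ hκ hlo e u).deriv]
  have hmem := one_sub_ppSmoothRatio_mem_Icc hlo e u
  have hk : |κ (1 - ppSmoothRatio lo e u)| ≤ κ₀ := hκb _ hmem
  have hk' : |κ' (1 - ppSmoothRatio lo e u)| ≤ κ₁ := hκ'b _ hmem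
  have hP' : |ppTrueKernelDu β Λ e u| ≤ (64 * B₂ + 120 * B₁ + 158 + (12 * B₁ + 5) * K) * M⁻¹ ^ 2 := by
    rcases he.lt_or_gt with hneg | hpos
    · have h := abs_ppTrueKernelDu_le_inv_max_sq_of_le_mul hβ hΛ hB₁ hB₂ hK (neg_pos.2 hneg) (by rwa [abs_of_neg hneg] at heK) (-u)
      rw [ppTrueKernelDu_neg_neg, abs_neg, abs_neg] at h
      rwa [hM, abs_of_neg hneg]
    · have h := abs_ppTrueKernelDu_le_inv_max_sq_of_le_mul hβ hΛ hB₁ hB₂ hK hpos (by rwa [abs_of_pos hpos] at heK) u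
      rwa [hM, abs_of_pos hpos]
  have hP := abs_ppTrueKernel_le_inv_max_abs hβ hΛ hB₁ he u
  have hr' : |-((-(ppSmoothScale lo e * (u / ppSmoothScale lo u)) / (ppSmoothScale lo e + ppSmoothScale lo u) ^ 2))| ≤ M⁻¹ := by
    rw [abs_neg]; exact (abs_ppSmoothRatioD1_le hlo e u).trans (inv_ppSmoothScale_add_le_inv_max hlo he u)
  have hA : |ppTrueKernelDu β Λ e u * κ (1 - ppSmoothRatio lo e u)| ≤ (64 * B₂ + 120 * B₁ + 158 + (12 * B₁ + 5) * K) * M⁻¹ ^ 2 * κ₀ := by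
    rw [abs_mul]; exact mul_le_mul hP' hk (abs_nonneg _) (by positivity)
  have hB : |ppTrueKernel β Λ e u * (κ' (1 - ppSmoothRatio lo e u) * -((-(ppSmoothScale lo e * (u / ppSmoothScale lo u)) / (ppSmoothScale lo e + ppSmoothScale lo u) ^ 2)))| ≤ (12 * B₁ + 9) * M⁻¹ * (κ₁ * M⁻¹) := by
    rw [abs_mul, abs_mul]; exact mul_le_mul hP (mul_le_mul hk' hr' (abs_nonneg _) hκ₁) (by positivity) (by positivity)
  refine ((abs_add_le _ _).trans (add_le_add hA hB)).trans (le_of_eq ?_)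
  ring

set_option maxHeartbeats 400000 in
include hβ hΛ hB₁ hκ hκb hκ'b hlo hloΛ in
/-- **Strip derivative envelope (row `hKs1`)**: `|e| ≤ lo ≤ Λ ⟹ |∂ᵤ[swap A_s](e,u)| ≤ (κ₀(128B₁+72) + 8κ₁)·(max lo |u|)⁻¹²`.
[cite: BenfattoGiulianiMastropietro2006, §2.4 (2.36)] -/
theorem abs_deriv_ppFarKernelS_swap_strip_le {e : ℝ} (he : |e| ≤ lo) (u : ℝ) :
    |deriv (fun v : ℝ => ppFarKernelS β Λ κ lo v e) u| ≤ (κ₀ * (128 * B₁ + 72) + 8 * κ₁) * (max lo |u|)⁻¹ ^ 2 := by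
  have hB0 := salmhoferB₁_nonneg hB₁
  have hκ₀ : 0 ≤ κ₀ := (abs_nonneg _).trans (hκb 0 (left_mem_Icc.2 zero_le_one))
  have hκ₁ : 0 ≤ κ₁ := (abs_nonneg _).trans (hκ'b 0 (left_mem_Icc.2 zero_le_one))
  have heΛ : |e| ≤ Λ := he.trans hloΛ
  set M : ℝ := max lo |u| with hM
  have hM0 : 0 < M := hlo.trans_le (le_max_left _ _)
  have hMΛ : M ≤ max Λ |u| := max_le_max hloΛ le_rfl
  have hinv1 : (max Λ |u|)⁻¹ ≤ M⁻¹ := inv_anti₀ hM0 hMΛ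
  have hinv2 : (max Λ |u|)⁻¹ ^ 2 ≤ M⁻¹ ^ 2 := pow_le_pow_left₀ (inv_nonneg.2 (hM0.le.trans hMΛ)) hinv1 2
  rw [(hasDerivAt_ppFarKernelS_swap_u hβ hΛ hB₁ hκ hlo e u).deriv]
  have hmem := one_sub_ppSmoothRatio_mem_Icc hlo e u
  have hk : |κ (1 - ppSmoothRatio lo e u)| ≤ κ₀ := hκb _ hmem
  have hk' : |κ' (1 - ppSmoothRatio lo e u)| ≤ κ₁ := hκ'b _ hmem
  have hP' := (abs_ppTrueKernelDu_strip_le_inv_max_sq hβ hΛ hB₁ heΛ u).trans (mul_le_mul_of_nonneg_left hinv2 (by positivity))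
  have hP := (abs_ppTrueKernel_strip_le_inv_max hβ hΛ heΛ u).trans (mul_le_mul_of_nonneg_left hinv1 (by norm_num))
  have hr' : |-((-(ppSmoothScale lo e * (u / ppSmoothScale lo u)) / (ppSmoothScale lo e + ppSmoothScale lo u) ^ 2))| ≤ M⁻¹ := by
    rw [abs_neg]
    refine (abs_ppSmoothRatioD1_le hlo e u).trans ?_
    have h1 := le_ppSmoothScale hlo.le e
    have h2 := abs_le_ppSmoothScale lo u
    rw [one_div]
    exact inv_anti₀ hM0 (max_le (by linarith [ppSmoothScale_pos hlo u]) (by linarith [ppSmoothScale_pos hlo e]))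
  have hA : |ppTrueKernelDu β Λ e u * κ (1 - ppSmoothRatio lo e u)| ≤ (128 * B₁ + 72) * M⁻¹ ^ 2 * κ₀ := by
    rw [abs_mul]; exact mul_le_mul hP' hk (abs_nonneg _) (by positivity)
  have hB : |ppTrueKernel β Λ e u * (κ' (1 - ppSmoothRatio lo e u) * -((-(ppSmoothScale lo e * (u / ppSmoothScale lo u)) / (ppSmoothScale lo e + ppSmoothScale lo u) ^ 2)))| ≤ 8 * M⁻¹ * (κ₁ * M⁻¹) := by
    rw [abs_mul, abs_mul]; exact mul_le_mul hP (mul_le_mul hk' hr' (abs_nonneg _) hκ₁) (by positivity) (by positivity)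
  refine ((abs_add_le _ _).trans (add_le_add hA hB)).trans (le_of_eq ?_)
  ring

set_option maxHeartbeats 400000 in
include hβ hΛ hB₁ hB₂ hκ hκ' hκ''c hκb hκ'b hlo hloΛ in
/-- **THE SIX ROWS OF B-1 (vi) FOR `Kr := swap A_s/C`** (`Kr e u = A_s(u,e)/C`; binder order `hKd, hKc, hK0, hK0s, hK1, hKs1`): level box `hi ≤ K·Λ` (`1 ≤ K`),
normalisation `κ₀(12B₁+9) ≤ C`, `κ₀(64B₂+120B₁+158+(12B₁+5)K) + κ₁(12B₁+9) ≤ C`, `κ₀(128B₁+72) + 8κ₁ ≤ C`; profile `κ ∈ C²` with `|κ| ≤ κ₀`, `|κ′| ≤ κ₁` on `[0,1]`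
(no death / flatness hypothesis needed). [cite: BenfattoGiulianiMastropietro2006, §2.4 (2.36)] -/
theorem ppFarKernelSSwap_firstOrderRows {hi K C : ℝ} (hK : 1 ≤ K) (hhiK : hi ≤ K * Λ) (hC : 0 < C) (hC0 : κ₀ * (12 * B₁ + 9) ≤ C)
    (hC1 : κ₀ * (64 * B₂ + 120 * B₁ + 158 + (12 * B₁ + 5) * K) + κ₁ * (12 * B₁ + 9) ≤ C) (hCs : κ₀ * (128 * B₁ + 72) + 8 * κ₁ ≤ C) :
    (∀ e ∈ Icc (-hi) hi, ContDiff ℝ 1 (fun v : ℝ => ppFarKernelS β Λ κ lo v e / C)) ∧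
    (Continuous fun p : ℝ × ℝ => deriv (fun v : ℝ => ppFarKernelS β Λ κ lo v p.1 / C) p.2) ∧
    (∀ e ∈ Icc (-hi) hi, e ≠ 0 → ∀ u, |ppFarKernelS β Λ κ lo u e / C| ≤ (max |e| |u|)⁻¹) ∧
    (∀ e ∈ Icc (-lo) lo, ∀ u, |ppFarKernelS β Λ κ lo u e / C| ≤ (max lo |u|)⁻¹) ∧
    (∀ e ∈ Icc (-hi) hi, e ≠ 0 → ∀ u, |deriv (fun v : ℝ => ppFarKernelS β Λ κ lo v e / C) u| ≤ (max |e| |u|)⁻¹ ^ 2) ∧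
    (∀ e ∈ Icc (-lo) lo, ∀ u, |deriv (fun v : ℝ => ppFarKernelS β Λ κ lo v e / C) u| ≤ (max lo |u|)⁻¹ ^ 2) := by
  have hB10 : 0 ≤ B₁ := salmhoferB₁_nonneg hB₁
  have hκ₀ : 0 ≤ κ₀ := (abs_nonneg _).trans (hκb 0 (left_mem_Icc.2 zero_le_one))
  have hκ'c : Continuous κ' := continuous_iff_continuousAt.2 fun t => (hκ' t).continuousAt
  have h8 : 8 * κ₀ ≤ C := by nlinarith only [hC0, mul_nonneg hκ₀ hB10, hκ₀]
  refine ⟨fun e _ => ((contDiff_two_ppFarKernelS_swap_u hβ hΛ hB₁ hB₂ hκ hκ' hκ''c hlo e).of_le (by norm_num)).div_const C, ?_,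
    fun e _ he u => abs_div_le_of_le (abs_ppFarKernelS_swap_le_inv_max hβ hΛ hB₁ hκb hlo he u) hC0 hC (by positivity),
    fun e he u => abs_div_le_of_le (abs_ppFarKernelS_swap_strip_le hβ hΛ hκb hlo hloΛ (abs_le.2 ⟨he.1, he.2⟩) u) h8 hC (by positivity),
    fun e he hne u => ?_, fun e he u => ?_⟩
  · have h : (fun p : ℝ × ℝ => deriv (fun v : ℝ => ppFarKernelS β Λ κ lo v p.1 / C) p.2) =
        fun p => deriv (fun v : ℝ => ppFarKernelS β Λ κ lo v p.1) p.2 / C := funext fun p => by rw [deriv_div_const]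
    rw [h]
    exact (continuous_deriv_ppFarKernelS_swap₂ hβ hΛ hB₁ hκ hlo hκ'c).div_const C
  · rw [deriv_div_const]
    have heK : |e| ≤ K * Λ := (abs_le.2 ⟨he.1, he.2⟩).trans hhiK
    exact abs_div_le_of_le (abs_deriv_ppFarKernelS_swap_le hβ hΛ hB₁ hB₂ hκ hκb hκ'b hlo hK hne heK u) hC1 hC (by positivity)
  · rw [deriv_div_const]
    have he' : |e| ≤ lo := abs_le.2 ⟨he.1, he.2⟩
    exact abs_div_le_of_le (abs_deriv_ppFarKernelS_swap_strip_le hβ hΛ hB₁ hκ hκb hκ'b hlo hloΛ he' u) hCs hC (by positivity)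

end Swap

set_option maxHeartbeats 400000 in
/-- **CONCRETE TWIN FOR `swap A_s`**: `ppFarKernelSSwap_firstOrderRows` at `sκ := ppSplitProfile t₁` (κ₀ = 1, κ₁ = 6/t₁) and
`C := Cˢʷ(B₁,B₂,K,t₁) = (12B₁+9) + (64B₂+120B₁+158+(12B₁+5)K + (6/t₁)(12B₁+9)) + (128B₁+72 + 8·(6/t₁))`; kernel inputs `0 < βT`, `0 < Λ`, `|χ′| ≤ B₁`, `|χ″| ≤ B₂`,
`0 < t₁`, `0 < lo ≤ Λ`, `1 ≤ K`, `hi ≤ K·Λ` only. [cite: BenfattoGiulianiMastropietro2006, §2.4 (2.36)] -/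
theorem ppFarKernelSSwapSplit_firstOrderRows {βT Λ : ℝ} (hkβ : 0 < βT) (hkΛ : 0 < Λ) {B₁ B₂ : ℝ} (hkB₁ : ∀ x, |deriv salmhoferCutoff x| ≤ B₁)
    (hkB₂ : ∀ x, |deriv (deriv salmhoferCutoff) x| ≤ B₂) {t₁ : ℝ} (hkt₀ : 0 < t₁) {lo hi K : ℝ} (hlo0 : 0 < lo) (hkloΛ : lo ≤ Λ) (hK : 1 ≤ K)
    (hhiK : hi ≤ K * Λ) :
    (∀ e ∈ Icc (-hi) hi, ContDiff ℝ 1 (fun v : ℝ => ppFarKernelS βT Λ (ppSplitProfile t₁) lo v e / (1 * (12 * B₁ + 9) +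
      (1 * (64 * B₂ + 120 * B₁ + 158 + (12 * B₁ + 5) * K) + (6 / t₁) * (12 * B₁ + 9)) +
      (1 * (128 * B₁ + 72) + 8 * (6 / t₁))))) ∧
    (Continuous fun p : ℝ × ℝ => deriv (fun v : ℝ => ppFarKernelS βT Λ (ppSplitProfile t₁) lo v p.1 / (1 * (12 * B₁ + 9) +
      (1 * (64 * B₂ + 120 * B₁ + 158 + (12 * B₁ + 5) * K) + (6 / t₁) * (12 * B₁ + 9)) +
      (1 * (128 * B₁ + 72) + 8 * (6 / t₁)))) p.2) ∧
    (∀ e ∈ Icc (-hi) hi, e ≠ 0 → ∀ u, |ppFarKernelS βT Λ (ppSplitProfile t₁) lo u e / (1 * (12 * B₁ + 9) +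
      (1 * (64 * B₂ + 120 * B₁ + 158 + (12 * B₁ + 5) * K) + (6 / t₁) * (12 * B₁ + 9)) +
      (1 * (128 * B₁ + 72) + 8 * (6 / t₁)))| ≤ (max |e| |u|)⁻¹) ∧
    (∀ e ∈ Icc (-lo) lo, ∀ u, |ppFarKernelS βT Λ (ppSplitProfile t₁) lo u e / (1 * (12 * B₁ + 9) +
      (1 * (64 * B₂ + 120 * B₁ + 158 + (12 * B₁ + 5) * K) + (6 / t₁) * (12 * B₁ + 9)) +
      (1 * (128 * B₁ + 72) + 8 * (6 / t₁)))| ≤ (max lo |u|)⁻¹) ∧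
    (∀ e ∈ Icc (-hi) hi, e ≠ 0 → ∀ u, |deriv (fun v : ℝ => ppFarKernelS βT Λ (ppSplitProfile t₁) lo v e / (1 * (12 * B₁ + 9) +
      (1 * (64 * B₂ + 120 * B₁ + 158 + (12 * B₁ + 5) * K) + (6 / t₁) * (12 * B₁ + 9)) +
      (1 * (128 * B₁ + 72) + 8 * (6 / t₁)))) u| ≤ (max |e| |u|)⁻¹ ^ 2) ∧
    (∀ e ∈ Icc (-lo) lo, ∀ u, |deriv (fun v : ℝ => ppFarKernelS βT Λ (ppSplitProfile t₁) lo v e / (1 * (12 * B₁ + 9) +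
      (1 * (64 * B₂ + 120 * B₁ + 158 + (12 * B₁ + 5) * K) + (6 / t₁) * (12 * B₁ + 9)) +
      (1 * (128 * B₁ + 72) + 8 * (6 / t₁)))) u| ≤ (max lo |u|)⁻¹ ^ 2) := by
  obtain ⟨h1, h2, h3, h4, h5, -, -, -, -⟩ := ppSplitProfile_admissible hkt₀
  have hB10 : 0 ≤ B₁ := salmhoferB₁_nonneg hkB₁
  have hB20 : 0 ≤ B₂ := (abs_nonneg _).trans (hkB₂ 0)
  have hK0 : 0 ≤ K := zero_le_one.trans hK
  have ht : 0 ≤ 6 / t₁ := by positivity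
  exact ppFarKernelSSwap_firstOrderRows hkβ hkΛ hkB₁ hkB₂ h1 h2 h3 h4 h5 hlo0 hkloΛ hK hhiK (by positivity) (by nlinarith [hB10, hB20, hK0, ht])
    (by nlinarith [hB10, hB20, hK0, ht]) (by nlinarith [hB10, hB20, hK0, ht])

end Summit.HubbardSuperconductivity.HubbardSuperconductivity.Theorems.C4a

end
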